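import Summits.NavierStokesRegularity.NavierStokesRegularity.Theorems.ExtremiserTransienceAveragedRung
import HarnessLib

/-!
# Route `ExtremiserTransience`, crux `NearExtremalTransience` (stmt-NavierStokesRegularity-21883):
# THE ENDPOINTS OF THE `θ`-FAMILY — `θ = 0` is exactly the hard core stmt-1217, `θ = 1` is a theorem

`--supports stmt-NavierStokesRegularity-21883`. Author: prover seat `ns-et-p1-g0`.

Write `N(θ)` for the matrix of the crux at level `θ` (for every universal depletion constant `κ` and every Type-I
singular classical Leray–Hopf rapidly-decaying-datum flow: an onset, a measurable flow-wise coefficient `k ∈ [0,1]` and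
`B` with `∫_{t₁}^t k²/(T−τ) ≤ (θκ)² log((T−t₁)/(T−t)) + B`); the crux is `∃ θ ∈ [0,1), N(θ)`.

* `nearExtremalTransience_body_mono` — `N` is monotone: `0 ≤ θ ≤ θ'` and `N(θ)` give `N(θ')` (universal constants
  are positive, `StrainCube.universal_depletion_constant_gt`).
* `nearExtremalTransience_body_zero_iff_target` — **`N(0) ↔ ThreadingFlux.Target`** (stmt-NavierStokesRegularity-1217,
  no Type-I blow-up for Clay data): `←` is the vacuous direction (`nearExtremalTransience_of_target`); `→` because a
  log-mean-bounded coefficient (`r = 0`) closes EVERY rung by the landed mean-form rung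
  `DepletionLadder.rung_of_logMeanDepletion` (`0·C < 1`), instantiated at the universal constant `(2+√3)/9`.
* Together with `nearExtremalTransience_body_one` (`N(1)` is a theorem, file `…ThetaOne.lean`): the crux family
  interpolates monotonically between a THEOREM (`θ = 1`) and the HARD CORE stmt-1217 (`θ = 0`); the crux asks for the
  first `θ < 1`. Every `N(θ)`, `θ < 1`, implies the rungs `X_C`, `C < 1/(θ·(2+√3)/9)` (`rung_of_nearExtremalTransience`).

WHAT THIS IS NOT: no `N(θ)` with `θ < 1` is proved; stmt-1217, the crux, the route and the summit stay open. [folklore]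
-/

noncomputable section

open Set Filter Topology MeasureTheory
open scoped InnerProductSpace RealInnerProductSpace ENNReal NNReal ContDiff
open Literature.Analysis.FluidPDE

namespace Summit.NavierStokesRegularity.NavierStokesRegularity.Theorems

-- the problem directory repeats the summit name (`NavierStokesRegularity/NavierStokesRegularity`)
set_option linter.dupNamespace false

open DepletionLadder

/-- **Monotonicity of the crux family in `θ`.** If `0 ≤ θ ≤ θ'` then `N(θ) → N(θ')` (same witnesses; `(θκ)² ≤ (θ'κ)²`
because every universal depletion constant is positive, `StrainCube.universal_depletion_constant_gt`). [folklore] -/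
theorem nearExtremalTransience_body_mono {θ θ' : ℝ} (hθ : 0 ≤ θ) (hθθ' : θ ≤ θ') :
    (∀ κ : ℝ, (∀ (v : EuclideanSpace ℝ (Fin 3) → EuclideanSpace ℝ (Fin 3)) (M B : ℝ), ContDiff ℝ (⊤ : ℕ∞) v → Literature.Analysis.FluidPDE.VectorCalculus.IsDivFree v → (∀ x, ‖v x‖ ≤ M) → (∀ x, ‖fderiv ℝ v x‖ ≤ B) → (∫⁻ x, ‖iteratedFDeriv ℝ 0 v x‖ₑ ^ 2 < ⊤) → (∫⁻ x, ‖iteratedFDeriv ℝ 1 v x‖ₑ ^ 2 < ⊤) → (∫⁻ x, ‖iteratedFDeriv ℝ 2 v x‖ₑ ^ 2 < ⊤) → |∫ x, ⟪Literature.Analysis.FluidPDE.curl v x, fderiv ℝ v x (Literature.Analysis.FluidPDE.curl v x)⟫_ℝ| ≤ κ * M * Real.sqrt (∫ x, ‖Literature.Analysis.FluidPDE.curl v x‖ ^ 2) * Real.sqrt (∫ x, Literature.Analysis.FluidPDE.frobeniusNormSq (fderiv ℝ (Literature.Analysis.FluidPDE.curl v) x))) → ∀ (C ν T : ℝ), 0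 < C → 0 < ν → 0 < T → ∀ (u : ℝ → EuclideanSpace ℝ (Fin 3) → EuclideanSpace ℝ (Fin 3)) (p : ℝ → EuclideanSpace ℝ (Fin 3) → ℝ), Literature.Analysis.FluidPDE.IsClassicalNSSolutionOn (Set.Ico 0 T) ν 0 u p → Literature.Analysis.FluidPDE.IsLerayHopfOn T ν 0 (u 0) u → Literature.Analysis.FluidPDE.HasRapidSpatialDecay (u 0) → (∀ᶠ t in 𝓝[<] T, ∀ x, Real.sqrt (T - t) * ‖u t x‖ ≤ C * Real.sqrt ν) → ¬ Literature.Analysis.FluidPDE.HasSmoothExtensionPast ν 0 u T → ∃ t₁ ∈ Set.Ico 0 T, ∃ (k : ℝ → ℝ) (B : ℝ), Measurable k ∧ (∀ τ, 0 ≤ k τ ∧ k τ ≤ 1) ∧ (∀ t ∈ Set.Ico t₁ T, ∀ M : ℝ, (∀ x, ‖u t x‖ ≤ M) → |∫ x, ⟪Literature.Analysis.FluidPDE.curl (u t) x, fderiv ℝ (u t) x (Literature.Analysis.FluidPDE.curl (u t) x)⟫_ℝ| ≤ k t * M * Real.sqrt (∫ x, ‖Literature.Analysis.FluidPDE.curl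 (u t) x‖ ^ 2) * Real.sqrt (∫ x, Literature.Analysis.FluidPDE.frobeniusNormSq (fderiv ℝ (Literature.Analysis.FluidPDE.curl (u t)) x))) ∧ (∀ t ∈ Set.Ico t₁ T, ∫ τ in t₁..t, k τ ^ 2 / (T - τ) ≤ (θ * κ) ^ 2 * Real.log ((T - t₁) / (T - t)) + B)) →
    (∀ κ : ℝ, (∀ (v : EuclideanSpace ℝ (Fin 3) → EuclideanSpace ℝ (Fin 3)) (M B : ℝ), ContDiff ℝ (⊤ : ℕ∞) v → Literature.Analysis.FluidPDE.VectorCalculus.IsDivFree v → (∀ x, ‖v x‖ ≤ M) → (∀ x, ‖fderiv ℝ v x‖ ≤ B) → (∫⁻ x, ‖iteratedFDeriv ℝ 0 v x‖ₑ ^ 2 < ⊤) → (∫⁻ x, ‖iteratedFDeriv ℝ 1 v x‖ₑ ^ 2 < ⊤) → (∫⁻ x, ‖iteratedFDeriv ℝ 2 v x‖ₑ ^ 2 < ⊤) → |∫ x, ⟪Literature.Analysis.FluidPDE.curl v x, fderiv ℝ v x (Literature.Analysis.FluidPDE.curl v x)⟫_ℝ| ≤ κ * M * Real.sqrt (∫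 x, ‖Literature.Analysis.FluidPDE.curl v x‖ ^ 2) * Real.sqrt (∫ x, Literature.Analysis.FluidPDE.frobeniusNormSq (fderiv ℝ (Literature.Analysis.FluidPDE.curl v) x))) → ∀ (C ν T : ℝ), 0 < C → 0 < ν → 0 < T → ∀ (u : ℝ → EuclideanSpace ℝ (Fin 3) → EuclideanSpace ℝ (Fin 3)) (p : ℝ → EuclideanSpace ℝ (Fin 3) → ℝ), Literature.Analysis.FluidPDE.IsClassicalNSSolutionOn (Set.Ico 0 T) ν 0 u p → Literature.Analysis.FluidPDE.IsLerayHopfOn T ν 0 (u 0) u → Literature.Analysis.FluidPDE.HasRapidSpatialDecay (u 0) → (∀ᶠ t in 𝓝[<] T, ∀ x, Real.sqrt (T - t) * ‖u t x‖ ≤ C * Real.sqrt ν) → ¬ Literature.Analysis.FluidPDE.HasSmoothExtensionPast ν 0 u T → ∃ t₁ ∈ Set.Ico 0 T, ∃ (k : ℝ → ℝ) (B : ℝ), Measurable k ∧ (∀ τ, 0 ≤ k τ ∧ k τ ≤ 1) ∧ (∀ t ∈ Set.Ico t₁ T, ∀ M : ℝ, (∀ x, ‖u t x‖ ≤ M)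 → |∫ x, ⟪Literature.Analysis.FluidPDE.curl (u t) x, fderiv ℝ (u t) x (Literature.Analysis.FluidPDE.curl (u t) x)⟫_ℝ| ≤ k t * M * Real.sqrt (∫ x, ‖Literature.Analysis.FluidPDE.curl (u t) x‖ ^ 2) * Real.sqrt (∫ x, Literature.Analysis.FluidPDE.frobeniusNormSq (fderiv ℝ (Literature.Analysis.FluidPDE.curl (u t)) x))) ∧ (∀ t ∈ Set.Ico t₁ T, ∫ τ in t₁..t, k τ ^ 2 / (T - τ) ≤ (θ' * κ) ^ 2 * Real.log ((T - t₁) / (T - t)) + B)) := by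
  intro H κ hκ C ν T hC hν hT u p hsol hLH hdec hrate hext
  obtain ⟨t₁, ht₁, k, B, hkm, hk01, hflow, hmean⟩ := H κ hκ C ν T hC hν hT u p hsol hLH hdec hrate hext
  refine ⟨t₁, ht₁, k, B, hkm, hk01, hflow, fun t ht => (hmean t ht).trans ?_⟩
  have hκ0 : 0 ≤ κ := le_of_lt (lt_trans (by norm_num) (StrainCube.universal_depletion_constant_gt hκ))
  have hlog : 0 ≤ Real.log ((T - t₁) / (T - t)) :=
    Real.log_nonneg ((one_le_div (sub_pos.2 ht.2)).2 (by linarith [ht.1]))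
  have hsq : (θ * κ) ^ 2 ≤ (θ' * κ) ^ 2 :=
    pow_le_pow_left₀ (mul_nonneg hθ hκ0) (mul_le_mul_of_nonneg_right hθθ' hκ0) 2
  linarith [mul_le_mul_of_nonneg_right hsq hlog]

/-- **The endpoint `θ = 0` of the crux family IS the hard core.** `N(0)` (for every universal `κ` and every Type-I
singular classical Leray–Hopf rapidly-decaying-datum flow, a measurable flow-wise coefficient `k ∈ [0,1]` with BOUNDED
log-time mass `∫_{t₁}^t k²/(T−τ) ≤ B`) holds iff `ThreadingFlux.Target` (stmt-NavierStokesRegularity-1217: every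
classical Leray–Hopf rapidly-decaying-datum solution on `[0,T)` with a Type-I rate extends past `T`). `→`: given a
Type-I flow with constant `C'`, the dimensionless rate `C = max(C'/√ν, 1)` holds eventually; if the flow did not extend,
`N(0)` at the universal constant `(2+√3)/9` (`StrainCube.sharp_constant_is_universal`) would give a coefficient with
log-mean level `r = 0`, and `rung_of_logMeanDepletion` (`0·C < 1`) extends it — contradiction. `←`: under `Target`
the non-extension hypothesis is never met (`nearExtremalTransience_of_target`). [folklore] -/
theorem nearExtremalTransience_body_zero_iff_target :
    (∀ κ : ℝ, (∀ (v : EuclideanSpace ℝ (Fin 3) → EuclideanSpace ℝ (Fin 3)) (M B : ℝ), ContDiff ℝ (⊤ : ℕ∞) v → Literature.Analysis.FluidPDE.VectorCalculus.IsDivFree v → (∀ x, ‖v x‖ ≤ M) → (∀ x, ‖fderiv ℝ v x‖ ≤ B) → (∫⁻ x, ‖iteratedFDeriv ℝ 0 v x‖ₑ ^ 2 < ⊤) → (∫⁻ x, ‖iteratedFDeriv ℝ 1 v x‖ₑ ^ 2 < ⊤) → (∫⁻ x, ‖iteratedFDeriv ℝ 2 v x‖ₑ ^ 2 < ⊤)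 → |∫ x, ⟪Literature.Analysis.FluidPDE.curl v x, fderiv ℝ v x (Literature.Analysis.FluidPDE.curl v x)⟫_ℝ| ≤ κ * M * Real.sqrt (∫ x, ‖Literature.Analysis.FluidPDE.curl v x‖ ^ 2) * Real.sqrt (∫ x, Literature.Analysis.FluidPDE.frobeniusNormSq (fderiv ℝ (Literature.Analysis.FluidPDE.curl v) x))) → ∀ (C ν T : ℝ), 0 < C → 0 < ν → 0 < T → ∀ (u : ℝ → EuclideanSpace ℝ (Fin 3) → EuclideanSpace ℝ (Fin 3)) (p : ℝ → EuclideanSpace ℝ (Fin 3) → ℝ), Literature.Analysis.FluidPDE.IsClassicalNSSolutionOn (Set.Ico 0 T) ν 0 u p → Literature.Analysis.FluidPDE.IsLerayHopfOn T ν 0 (u 0) u → Literature.Analysis.FluidPDE.HasRapidSpatialDecay (u 0) → (∀ᶠ t in 𝓝[<] T, ∀ x, Real.sqrt (T - t) * ‖u t x‖ ≤ C * Real.sqrt ν) → ¬ Literature.Analysis.FluidPDE.HasSmoothExtensionPast ν 0 u T → ∃ t₁ ∈ Set.Ico 0 T, ∃ (k : ℝ → ℝ) (B : ℝ), Measurable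 k ∧ (∀ τ, 0 ≤ k τ ∧ k τ ≤ 1) ∧ (∀ t ∈ Set.Ico t₁ T, ∀ M : ℝ, (∀ x, ‖u t x‖ ≤ M) → |∫ x, ⟪Literature.Analysis.FluidPDE.curl (u t) x, fderiv ℝ (u t) x (Literature.Analysis.FluidPDE.curl (u t) x)⟫_ℝ| ≤ k t * M * Real.sqrt (∫ x, ‖Literature.Analysis.FluidPDE.curl (u t) x‖ ^ 2) * Real.sqrt (∫ x, Literature.Analysis.FluidPDE.frobeniusNormSq (fderiv ℝ (Literature.Analysis.FluidPDE.curl (u t)) x))) ∧ (∀ t ∈ Set.Ico t₁ T, ∫ τ in t₁..t, k τ ^ 2 / (T - τ) ≤ (0 * κ) ^ 2 * Real.log ((T - t₁) / (T - t)) + B)) ↔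
    Summit.NavierStokesRegularity.NavierStokesRegularity.Theses.ThreadingFlux.Target := by
  constructor
  · intro H ν T hν hT u p hsol hLH hdec hI
    obtain ⟨C', hC'⟩ := hI
    by_contra hext
    have hν' : 0 < Real.sqrt ν := Real.sqrt_pos.2 hν
    have hCpos : 0 < max (C' / Real.sqrt ν) 1 := lt_of_lt_of_le one_pos (le_max_right _ _)
    have hrate : ∀ᶠ t in 𝓝[<] T, ∀ x,
        Real.sqrt (T - t) * ‖u t x‖ ≤ max (C' / Real.sqrt ν) 1 * Real.sqrt ν := by
      have hlt : ∀ᶠ t in 𝓝[<] T, t < T := self_mem_nhdsWithin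
      filter_upwards [hC', hlt] with t ht htT
      intro x
      have hTt : 0 < Real.sqrt (T - t) := Real.sqrt_pos.2 (sub_pos.2 htT)
      calc Real.sqrt (T - t) * ‖u t x‖
          ≤ Real.sqrt (T - t) * (C' / Real.sqrt (T - t)) := mul_le_mul_of_nonneg_left (ht x) hTt.le
        _ = C' := by field_simp
        _ = (C' / Real.sqrt ν) * Real.sqrt ν := by field_simp
        _ ≤ max (C' / Real.sqrt ν) 1 * Real.sqrt ν := mul_le_mul_of_nonneg_right (le_max_left _ _) hν'.le
    obtain ⟨t₁, ht₁, k, B, hkm, hk01, hflow, hmean⟩ :=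
      H ((2 + Real.sqrt 3) / 9) StrainCube.sharp_constant_is_universal _ ν T hCpos hν hT u p hsol hLH hdec hrate hext
    have hmean' : ∀ t ∈ Ico t₁ T, ∫ τ in t₁..t, k τ ^ 2 / (T - τ) ≤
        (0:ℝ) ^ 2 * Real.log ((T - t₁) / (T - t)) + B := fun t ht => by
      simpa using hmean t ht
    have h0C : (0:ℝ) * max (C' / Real.sqrt ν) 1 < 1 := by simp
    exact hext (rung_of_logMeanDepletion hν hT le_rfl hCpos h0C ht₁ hsol hLH hdec hkm hk01 hflow hmean' hrate)
  · intro hX κ _ C ν T _ hν hT u p hsol hLH hdec hrate hext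
    exfalso
    refine hext (hX ν T hν hT u p hsol hLH hdec ⟨C * Real.sqrt ν, ?_⟩)
    filter_upwards [hrate, self_mem_nhdsWithin] with t ht htT
    intro x
    have hpos : 0 < Real.sqrt (T - t) := Real.sqrt_pos.2 (sub_pos.2 htT)
    rw [le_div_iff₀ hpos, mul_comm]
    exact ht x

end Summit.NavierStokesRegularity.NavierStokesRegularity.Theorems

end
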